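import Literature.Analysis.FluidPDE.DriftHeatOscillation
import Literature.Analysis.FluidPDE.HarnackChainCover
import Literature.Analysis.FluidPDE.ParabolicHarnackDriftGap
import Literature.Analysis.FluidPDE.KNSSSwirlSupNonpos
import Literature.Analysis.FluidPDE.KNSSThm53Reduction
import HarnessLib

/-!
# KNSS 2009, Lemma 2.1 from the interior Harnack inequality with waiting time
# (Lieberman 1996, Theorem 6.27, corrected rendering)

Analysis/FluidPDE proofs file. The tree's `KNSS2009_lemma21_of_harnack` (`KNSSLemma21OfHarnack`)
derives KNSS 2009, Lemma 2.1 (`Literature.Analysis.FluidPDE.KNSS2009_lemma21`, the stability of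
the strong maximum principle for `uₜ + a·∇u − Δu = 0` on a bounded domain) from the named fact
`Lieberman1996_harnack_drift`, whose early and late cylinders `Θ(R/2) = B(y,R/2) × (s − 5R²/4, s − R²)`
and `Q(R) = B(y,R) × (s − R², s)` are adjacent in time; that fact is **false**
(`not_Lieberman1996_harnack_drift`, `ParabolicHarnackDriftRefutation`), so the derivation is
vacuous. This file redoes the derivation from the corrected rendering
`Literature.Analysis.FluidPDE.Lieberman1996_harnack_drift_gap` (`ParabolicHarnackDriftGap`:
`Θ(R/2) = Q((y, s − 4R²), R/2) = B(y, R/2) × (s − 17R²/4, s − 4R²)`, a waiting time `3R²` before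
`Q(R)`, as in the book), for every finite-dimensional real inner product space `E`:

* `KNSS2009_lemma21_of_harnack_gap : Lieberman1996_harnack_drift_gap E → KNSS2009_lemma21 E`,

and re-threads the consumers: `KNSS2009_swirl_sup_nonpos_of_harnack_gap`,
`KNSS2009_liouville_bound_C_over_r_of_harnack_gap` (KNSS Theorem 5.3 as printed) and
`knss_bound_C_over_r_of_harnack_gap` (the tree's duality-form fact), each from Lieberman's
Theorem 6.27, the §4 regularity/swirl fact and Theorem 5.2.

## Proof

As in `KNSSLemma21OfHarnack` (oscillation decay backwards in time, then a Harnack chain), with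
the chain re-scheduled for the waiting time. For `w = M − u ≥ 0` (`0 ≤ w ≤ 2M`) suppose
`w(t, x) > εM` at some `x ∈ Ω'`, `τ < t < T`.

1. *Geometry* (`HarnackChainCover`): `Ω̄' ∪ K ⊆ S` compact connected with margin `m` in `Ω`;
   `r₀ = min(m/4, √τ/4)`; `C ≥ 1` a Harnack constant for radii `≤ r₀` (`IsHarnackConstForGap`).
2. *Oscillation decay* (`IsHarnackConstForGap.osc_iterate`; the Moser argument is insensitive to
   the waiting time): `θ = 1 − 1/C`, `θᵏ < ε/4`, `ρ = r₀/4ᵏ`; on `Q((x, s'), ρ)`,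
   `s' = min(T, t + ρ²/4)`, `osc w ≤ θᵏ · 2M ≤ εM/2`, whence `w(t₁, x) ≥ εM/2` at `t₁ = t − ρ²/2`.
3. *Harnack chain with lags `≈ 4R²`* (`IsHarnackConstForGap.chain`: consecutive space-time points
   `(σᵢ, Zᵢ)`, `(σᵢ₊₁, Zᵢ₊₁)` with `|Zᵢ₊₁ − Zᵢ| < R` are comparable as soon as a top `sᵢ ≤ T`
   exists with `σᵢ ∈ (sᵢ − 17R²/4, sᵢ − 4R²)`, `σᵢ₊₁ ∈ (sᵢ − R², sᵢ)`, i.e. for lags in a window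
   around `4R²`). The available time `t₂ − t₁ ∈ (ρ²/2, T]` (`t < t₂ < T`) is split into a
   **moving phase** — the uniform `ρ/8`-chain of `S` from `x` to `x_K` (`≤ N₁` steps,
   `exists_uniform_chain`) refined into `p = N₁ + 1` collinear sub-steps each (`refine_chain`),
   run with radius `ρ/(4p)` and equal lags `(7/2)(ρ/(4p))²`, which consumes at most `7ρ²/32` —
   and a **resting phase** at `x_K` with radius `ρ/32` and `n_B ≤ ⌈2¹⁰ T/(4ρ²)⌉ + 1` equal lags in
   `[4.05, 4.2] · (ρ/32)²` filling the remaining time exactly, the tops of the resting cylinders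
   being taken just above the later point (so that the last one stays below `T`). Hence
   `εM/2 ≤ C^{N} w(t₂, x_K)` with `N = N₁ p + ⌈2¹⁰T/(4ρ²)⌉ + 1` independent of the solution.
4. `t₂ → T` by the local time-Lipschitz bound, and `δ = ε/(4C^N)` as before.

## References

* G. Koch, N. Nadirashvili, G. Seregin, V. Šverák, *Liouville theorems for the Navier–Stokes
  equations and applications*, Acta Math. 203 (2009) = arXiv:0709.3599, Lemma 2.1 (p. 5).
  [KochNadirashviliSereginSverak2009]
* G. M. Lieberman, *Second Order Parabolic Differential Equations*, World Scientific (1996),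
  Ch. VI §6 (`Θ(R)`), §7 Theorems 6.25 (chaining), 6.27 (Harnack), 6.28 (Hölder). [Lieberman1996]
* J. Moser, *A Harnack inequality for parabolic differential equations*, Comm. Pure Appl. Math.
  17 (1964) 101–134.
-/

noncomputable section

open MeasureTheory Set Function Metric InnerProductSpace
open scoped Laplacian

namespace Literature.Analysis.FluidPDE

/-! ### Harnack constants with waiting time -/

section HarnackConst

variable (E : Type*) [NormedAddCommGroup E] [InnerProductSpace ℝ E] [FiniteDimensional ℝ E]
  [MeasurableSpace E]

/-- **"`C` is an interior Harnack constant, with waiting time, for drift bound `A` and radii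
`≤ R₀`"**: the matrix of the named fact `Lieberman1996_harnack_drift_gap` (Lieberman 1996,
Theorem 6.27, corrected rendering): for every open `Ω`, every jointly measurable drift with
`‖a‖ ≤ A` on `(0,T] × Ω`, every solution of the elementary time-integrated class and every
cylinder `Q((y,s), 4R)` (`0 < R ≤ R₀`, `B̄(y,4R) ⊆ Ω`, `16R² < s ≤ T`) on which `u ≥ 0`,
`u(t₁,x₁) ≤ C u(t₂,x₂)` for `(x₁,t₁) ∈ Θ(R/2) = B(y, R/2) × (s − 17R²/4, s − 4R²)` and
`(x₂,t₂) ∈ Q(R) = B(y, R) × (s − R², s)`. [cite: Lieberman1996, Ch. VI Thm 6.27] -/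
def IsHarnackConstForGap (A R₀ C : ℝ) : Prop :=
  ∀ ⦃Ω : Set E⦄ ⦃T : ℝ⦄ ⦃a : ℝ → E → E⦄ ⦃u : ℝ → E → ℝ⦄,
    IsOpen Ω →
    Measurable (uncurry a) → (∀ t ∈ Ioc 0 T, ∀ x ∈ Ω, ‖a t x‖ ≤ A) →
    (∀ t ∈ Ioc 0 T, ContDiffOn ℝ 2 (u t) Ω) →
    ContinuousOn (fun p : ℝ × E => fderiv ℝ (u p.1) p.2) (Ioc 0 T ×ˢ Ω) →
    ContinuousOn (fun p : ℝ × E => (Δ (u p.1)) p.2) (Ioc 0 T ×ˢ Ω) →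
    (∀ x ∈ Ω, ∀ s t : ℝ, 0 < s → s ≤ t → t ≤ T →
      u t x - u s x = ∫ r in s..t, ((Δ (u r)) x - fderiv ℝ (u r) x (a r x))) →
    ∀ ⦃y : E⦄ ⦃s R : ℝ⦄, 0 < R → R ≤ R₀ → closedBall y (4 * R) ⊆ Ω →
      16 * R ^ 2 < s → s ≤ T →
      (∀ t ∈ Ioo (s - 16 * R ^ 2) s, ∀ x ∈ ball y (4 * R), 0 ≤ u t x) →
      ∀ ⦃t₁ : ℝ⦄ ⦃x₁ : E⦄ ⦃t₂ : ℝ⦄ ⦃x₂ : E⦄,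
        t₁ ∈ Ioo (s - 17 / 4 * R ^ 2) (s - 4 * R ^ 2) → x₁ ∈ ball y (R / 2) →
        t₂ ∈ Ioo (s - R ^ 2) s → x₂ ∈ ball y R →
        u t₁ x₁ ≤ C * u t₂ x₂

variable {E}

/-- The named fact `Lieberman1996_harnack_drift_gap` provides, for every drift bound and
radius bound, a Harnack constant with waiting time, which may be taken `≥ 1`. [cite: Lieberman1996, Ch. VI Thm 6.27] -/
theorem Lieberman1996_harnack_drift_gap.exists_const [BorelSpace E]
    (h : Lieberman1996_harnack_drift_gap E) (A : ℝ) {R₀ : ℝ} (hR₀ : 0 < R₀) :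
    ∃ C : ℝ, 1 ≤ C ∧ IsHarnackConstForGap E A R₀ C := by
  obtain ⟨C, -, hC⟩ := @h A R₀ hR₀
  refine ⟨max C 1, le_max_right _ _, ?_⟩
  intro Ω T a u hΩ ham haA hu2 hDu hΔu hequ y s R hR hRR₀ hB hs hsT hpos t₁ x₁ t₂ x₂ ht₁ hx₁ ht₂ hx₂
  have h1 := hC hΩ ham haA hu2 hDu hΔu hequ hR hRR₀ hB hs hsT hpos ht₁ hx₁ ht₂ hx₂
  have h2 : 0 ≤ u t₂ x₂ := by
    refine hpos t₂ ⟨?_, ht₂.2⟩ x₂ (ball_subset_ball (by linarith) hx₂)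
    have : 0 < R ^ 2 := by positivity
    linarith [ht₂.1]
  calc u t₁ x₁ ≤ C * u t₂ x₂ := h1
    _ ≤ max C 1 * u t₂ x₂ := mul_le_mul_of_nonneg_right (le_max_left _ _) h2

end HarnackConst

section Consequences

variable {E : Type*} [NormedAddCommGroup E] [InnerProductSpace ℝ E] [FiniteDimensional ℝ E]
  [MeasurableSpace E]

variable {A R₀ C : ℝ} {Ω : Set E} {T : ℝ} {a : ℝ → E → E} {w : ℝ → E → ℝ}

/-- **The Harnack inequality with waiting time for a member of the local class** (unpacking
`IsHarnackConstForGap`). [cite: Lieberman1996, Ch. VI Thm 6.27] -/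
theorem IsHarnackConstForGap.apply (hC : IsHarnackConstForGap E A R₀ C) (hΩ : IsOpen Ω)
    (hw : IsDriftHeatSolutionOn a w A (Ioc 0 T) Ω) {y : E} {s R : ℝ} (hR : 0 < R)
    (hRR₀ : R ≤ R₀) (hB : closedBall y (4 * R) ⊆ Ω) (hs : 16 * R ^ 2 < s) (hsT : s ≤ T)
    (hpos : ∀ t ∈ Ioo (s - 16 * R ^ 2) s, ∀ x ∈ ball y (4 * R), 0 ≤ w t x)
    {t₁ : ℝ} {x₁ : E} {t₂ : ℝ} {x₂ : E} (ht₁ : t₁ ∈ Ioo (s - 17 / 4 * R ^ 2) (s - 4 * R ^ 2))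
    (hx₁ : x₁ ∈ ball y (R / 2)) (ht₂ : t₂ ∈ Ioo (s - R ^ 2) s) (hx₂ : x₂ ∈ ball y R) :
    w t₁ x₁ ≤ C * w t₂ x₂ :=
  hC hΩ hw.measurable_drift hw.norm_drift_le hw.contDiffOn hw.continuousOn_fderiv
    hw.continuousOn_laplacian hw.integral_eq_Ioc hR hRR₀ hB hs hsT hpos ht₁ hx₁ ht₂ hx₂

/-! ### Oscillation decay on top-aligned cylinders (insensitive to the waiting time) -/

/-- **Oscillation decay, one step** (Lieberman 1996, proof of Theorem 6.28, from the Harnack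
inequality with waiting time): if `m₄ ≤ w ≤ M₄` on `Q((x,s'), 4r)` (`B̄(x,4r) ⊆ Ω`,
`16r² < s' ≤ T`, `r ≤ R₀`), then on `Q((x,s'), r)` the oscillation of `w` is at most
`(1 − 1/C)(M₄ − m₄)`: apply Harnack to `M₄ − w` and `w − m₄` between the point
`(x, s' − 33r²/8) ∈ Θ(r/2)` and the points of `Q(r)`. [cite: Lieberman1996, Ch. VI Thm 6.28 (proof)] -/
theorem IsHarnackConstForGap.osc_step (hC : IsHarnackConstForGap E A R₀ C) (hC1 : 1 ≤ C)
    (hΩ : IsOpen Ω) (hw : IsDriftHeatSolutionOn a w A (Ioc 0 T) Ω) {x : E} {s' r m₄ M₄ : ℝ}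
    (hr : 0 < r) (hrR₀ : r ≤ R₀) (hB : closedBall x (4 * r) ⊆ Ω) (hs : 16 * r ^ 2 < s')
    (hsT : s' ≤ T)
    (hbd : ∀ t ∈ Ioo (s' - 16 * r ^ 2) s', ∀ z ∈ ball x (4 * r), m₄ ≤ w t z ∧ w t z ≤ M₄)
    {t : ℝ} {z : E} {t' : ℝ} {z' : E} (ht : t ∈ Ioo (s' - r ^ 2) s') (hz : z ∈ ball x r)
    (ht' : t' ∈ Ioo (s' - r ^ 2) s') (hz' : z' ∈ ball x r) :
    w t z - w t' z' ≤ (1 - 1 / C) * (M₄ - m₄) := by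
  have hCpos : 0 < C := by linarith
  have hr2 : 0 < r ^ 2 := by positivity
  have hw₁ : IsDriftHeatSolutionOn a (fun t z => -w t z + M₄) A (Ioc 0 T) Ω :=
    hw.neg.add_const hΩ ordConnected_Ioc M₄
  have hw₂ : IsDriftHeatSolutionOn a (fun t z => w t z + -m₄) A (Ioc 0 T) Ω :=
    hw.add_const hΩ ordConnected_Ioc (-m₄)
  have hpos₁ : ∀ t ∈ Ioo (s' - 16 * r ^ 2) s', ∀ z ∈ ball x (4 * r), 0 ≤ -w t z + M₄ :=
    fun t ht z hz => by linarith [(hbd t ht z hz).2]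
  have hpos₂ : ∀ t ∈ Ioo (s' - 16 * r ^ 2) s', ∀ z ∈ ball x (4 * r), 0 ≤ w t z + -m₄ :=
    fun t ht z hz => by linarith [(hbd t ht z hz).1]
  -- the reference point `(x, s' − 33r²/8) ∈ Θ(r/2)`
  have ht₁ : s' - 33 / 8 * r ^ 2 ∈ Ioo (s' - 17 / 4 * r ^ 2) (s' - 4 * r ^ 2) := by
    constructor <;> nlinarith
  have hx₁ : x ∈ ball x (r / 2) := mem_ball_self (by positivity)
  have h1 := hC.apply hΩ hw₁ hr hrR₀ hB hs hsT hpos₁ ht₁ hx₁ ht hz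
  have h2 := hC.apply hΩ hw₂ hr hrR₀ hB hs hsT hpos₂ ht₁ hx₁ ht' hz'
  have key : C * (w t z - w t' z') ≤ (C - 1) * (M₄ - m₄) := by nlinarith [h1, h2]
  have hθ : (1 - 1 / C) * (M₄ - m₄) = (C - 1) * (M₄ - m₄) / C := by
    field_simp
  rw [hθ, le_div_iff₀ hCpos]
  linarith [key]

/-- **Oscillation decay, iterated** (Lieberman 1996, Theorem 6.28, for solutions of
`wₜ + a·∇w − Δw = 0` with `m ≤ w ≤ M` on `(0,T] × Ω`, from the Harnack inequality with waiting
time): on the top-aligned cylinders `Q((x,s'), ρ/4ʲ)`, `B̄(x, ρ) ⊆ Ω`, `ρ² < s' ≤ T`,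
`ρ ≤ R₀`, the oscillation of `w` is at most `(1 − 1/C)ʲ (M − m)` — a modulus of continuity
backwards in time from every point up to the final time, uniform over the class. [cite: Lieberman1996, Ch. VI Thm 6.28] -/
theorem IsHarnackConstForGap.osc_iterate (hC : IsHarnackConstForGap E A R₀ C) (hC1 : 1 ≤ C)
    (hΩ : IsOpen Ω) (hw : IsDriftHeatSolutionOn a w A (Ioc 0 T) Ω) {m M : ℝ}
    (hbd : ∀ t ∈ Ioc 0 T, ∀ z ∈ Ω, m ≤ w t z ∧ w t z ≤ M) {x : E} {s' ρ : ℝ} (hρ : 0 < ρ)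
    (hρR₀ : ρ ≤ R₀) (hB : closedBall x ρ ⊆ Ω) (hs : ρ ^ 2 < s') (hsT : s' ≤ T) (j : ℕ)
    {t : ℝ} {z : E} {t' : ℝ} {z' : E} (ht : t ∈ Ioo (s' - (ρ / 4 ^ j) ^ 2) s')
    (hz : z ∈ ball x (ρ / 4 ^ j)) (ht' : t' ∈ Ioo (s' - (ρ / 4 ^ j) ^ 2) s')
    (hz' : z' ∈ ball x (ρ / 4 ^ j)) :
    w t z - w t' z' ≤ (1 - 1 / C) ^ j * (M - m) := by
  have hθ0 : 0 ≤ 1 - 1 / C := by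
    have : 1 / C ≤ 1 := by rw [div_le_one (by linarith)]; exact hC1
    linarith
  induction j generalizing t z t' z' with
  | zero =>
    simp only [pow_zero, div_one, one_mul] at ht hz ht' hz' ⊢
    obtain ⟨htm, hzm⟩ := cyl_mem hB hs hsT ht hz
    obtain ⟨htm', hzm'⟩ := cyl_mem hB hs hsT ht' hz'
    linarith [(hbd t htm z hzm).2, (hbd t' htm' z' hzm').1]
  | succ j ih =>
    set ρj : ℝ := ρ / 4 ^ j with hρj
    set r : ℝ := ρ / 4 ^ (j + 1) with hr
    have hρj_eq : ρj = 4 * r := by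
      simp only [hρj, hr, pow_succ]; field_simp
    have hrpos : 0 < r := by positivity
    have hρjpos : 0 < ρj := by positivity
    have hρj_le : ρj ≤ ρ := by
      rw [hρj, div_le_iff₀ (by positivity)]
      have : (1 : ℝ) ≤ 4 ^ j := one_le_pow₀ (by norm_num)
      nlinarith
    have hr_le : r ≤ R₀ := by
      have : r ≤ ρj := by rw [hρj_eq]; linarith
      exact this.trans (hρj_le.trans hρR₀)
    have hBr : closedBall x (4 * r) ⊆ Ω := by
      rw [← hρj_eq]; exact (closedBall_subset_closedBall hρj_le).trans hB
    have hsr : 16 * r ^ 2 < s' := by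
      have h1 : 16 * r ^ 2 = ρj ^ 2 := by rw [hρj_eq]; ring
      have h2 : ρj ^ 2 ≤ ρ ^ 2 := pow_le_pow_left₀ hρjpos.le hρj_le 2
      linarith
    set V : Set ℝ := (fun p : ℝ × E => w p.1 p.2) '' (Ioo (s' - ρj ^ 2) s' ×ˢ ball x ρj) with hV
    have hVne : V.Nonempty := by
      have hq : s' - ρj ^ 2 / 2 ∈ Ioo (s' - ρj ^ 2) s' := by
        have : 0 < ρj ^ 2 := by positivity
        constructor <;> linarith
      exact ⟨_, mem_image_of_mem _ (mk_mem_prod hq (mem_ball_self hρjpos))⟩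
    have hVmem : ∀ {q : ℝ} {ζ : E}, q ∈ Ioo (s' - ρj ^ 2) s' → ζ ∈ ball x ρj → w q ζ ∈ V :=
      fun hq hζ => mem_image_of_mem (fun p : ℝ × E => w p.1 p.2) (mk_mem_prod hq hζ)
    have hsj : ρj ^ 2 < s' := lt_of_le_of_lt (pow_le_pow_left₀ hρjpos.le hρj_le 2) hs
    have hVabove : BddAbove V := by
      refine ⟨M, ?_⟩
      rintro _ ⟨⟨q, ζ⟩, ⟨hq, hζ⟩, rfl⟩
      obtain ⟨hqm, hζm⟩ := cyl_mem ((closedBall_subset_closedBall hρj_le).trans hB) hsj hsT hq hζ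
      exact (hbd q hqm ζ hζm).2
    have hVbelow : BddBelow V := by
      refine ⟨m, ?_⟩
      rintro _ ⟨⟨q, ζ⟩, ⟨hq, hζ⟩, rfl⟩
      obtain ⟨hqm, hζm⟩ := cyl_mem ((closedBall_subset_closedBall hρj_le).trans hB) hsj hsT hq hζ
      exact (hbd q hqm ζ hζm).1
    set M₄ := sSup V with hM₄
    set m₄ := sInf V with hm₄
    have hdiff : M₄ - m₄ ≤ (1 - 1 / C) ^ j * (M - m) := by
      have h1 : ∀ v ∈ V, v ≤ m₄ + (1 - 1 / C) ^ j * (M - m) := by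
        rintro _ ⟨⟨q, ζ⟩, ⟨hq, hζ⟩, rfl⟩
        have h2 : w q ζ - (1 - 1 / C) ^ j * (M - m) ≤ m₄ := by
          refine le_csInf hVne ?_
          rintro _ ⟨⟨q', ζ'⟩, ⟨hq', hζ'⟩, rfl⟩
          have := ih hq hζ hq' hζ'
          simp only at this ⊢
          linarith
        simp only
        linarith
      have := csSup_le hVne h1
      linarith
    have hbd4 : ∀ q ∈ Ioo (s' - 16 * r ^ 2) s', ∀ ζ ∈ ball x (4 * r), m₄ ≤ w q ζ ∧ w q ζ ≤ M₄ := by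
      intro q hq ζ hζ
      have h16 : 16 * r ^ 2 = ρj ^ 2 := by rw [hρj_eq]; ring
      rw [h16] at hq
      rw [← hρj_eq] at hζ
      exact ⟨csInf_le hVbelow (hVmem hq hζ), le_csSup hVabove (hVmem hq hζ)⟩
    have hstep := hC.osc_step hC1 hΩ hw hrpos hr_le hBr hsr hsT hbd4 ht hz ht' hz'
    calc w t z - w t' z' ≤ (1 - 1 / C) * (M₄ - m₄) := hstep
      _ ≤ (1 - 1 / C) * ((1 - 1 / C) ^ j * (M - m)) := mul_le_mul_of_nonneg_left hdiff hθ0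
      _ = (1 - 1 / C) ^ (j + 1) * (M - m) := by rw [pow_succ]; ring

/-! ### Harnack chains with waiting time -/

/-- **Harnack chain with waiting time** (Lieberman 1996, Ch. VI, Theorem 6.25, "the chaining
argument"): for a nonnegative solution on `(0,T] × Ω`, points `Z₀, …, Zₙ` with
`|Zᵢ₊₁ − Zᵢ| < R`, `B̄(Zᵢ, 4R) ⊆ Ω`, and times `σ₀, …, σₙ` such that each consecutive pair
admits a top `sᵢ ≤ T`, `16R² < sᵢ`, with `σᵢ ∈ (sᵢ − 17R²/4, sᵢ − 4R²)` and
`σᵢ₊₁ ∈ (sᵢ − R², sᵢ)` (so the lag `σᵢ₊₁ − σᵢ` lies in a window around `4R²`), one has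
`w(σ₀, Z₀) ≤ Cⁿ w(σₙ, Zₙ)`. [cite: Lieberman1996, Ch. VI Thm 6.25 (chaining)] -/
theorem IsHarnackConstForGap.chain (hC : IsHarnackConstForGap E A R₀ C) (hC0 : 0 ≤ C)
    (hΩ : IsOpen Ω) (hw : IsDriftHeatSolutionOn a w A (Ioc 0 T) Ω)
    (hw0 : ∀ t ∈ Ioc 0 T, ∀ z ∈ Ω, 0 ≤ w t z)
    {R : ℝ} (hR : 0 < R) (hRR₀ : R ≤ R₀) (Z : ℕ → E) (σ : ℕ → ℝ) (n : ℕ)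
    (hZ : ∀ i < n, dist (Z (i + 1)) (Z i) < R) (hZΩ : ∀ i < n, closedBall (Z i) (4 * R) ⊆ Ω)
    (htop : ∀ i < n, ∃ s : ℝ, 16 * R ^ 2 < s ∧ s ≤ T ∧
      σ i ∈ Ioo (s - 17 / 4 * R ^ 2) (s - 4 * R ^ 2) ∧ σ (i + 1) ∈ Ioo (s - R ^ 2) s) :
    w (σ 0) (Z 0) ≤ C ^ n * w (σ n) (Z n) := by
  induction n with
  | zero => simp
  | succ n ih =>
    have h1 := ih (fun i hi => hZ i (by omega)) (fun i hi => hZΩ i (by omega))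
      (fun i hi => htop i (by omega))
    obtain ⟨s, hs, hsT, hσ, hσ'⟩ := htop n (by omega)
    have hpos : ∀ t ∈ Ioo (s - 16 * R ^ 2) s, ∀ z ∈ ball (Z n) (4 * R), 0 ≤ w t z := by
      intro t ht z hz
      have h16 : (4 * R) ^ 2 = 16 * R ^ 2 := by ring
      obtain ⟨htm, hzm⟩ := cyl_mem (T := T) (hZΩ n (by omega)) (by rw [h16]; exact hs) hsT
        (by rw [h16]; exact ht) hz
      exact hw0 t htm z hzm
    have h2 := hC.apply hΩ hw hR hRR₀ (hZΩ n (by omega)) hs hsT hpos hσ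
      (mem_ball_self (by positivity)) hσ' (hZ n (by omega))
    calc w (σ 0) (Z 0) ≤ C ^ n * w (σ n) (Z n) := h1
      _ ≤ C ^ n * (C * w (σ (n + 1)) (Z (n + 1))) := mul_le_mul_of_nonneg_left h2 (pow_nonneg hC0 n)
      _ = C ^ (n + 1) * w (σ (n + 1)) (Z (n + 1)) := by rw [pow_succ]; ring

end Consequences

/-! ### Refining a chain into collinear sub-steps -/

section Refine

variable {E : Type*} [NormedAddCommGroup E] [NormedSpace ℝ E]

/-- **Refinement of a chain.** A chain `z₀, …, z_L` with steps `‖zᵢ₊₁ − zᵢ‖ < R` can be refined,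
for every `p ≥ 1`, into the chain `z'ᵢ = z_{i/p} + ((i mod p)/p)(z_{i/p+1} − z_{i/p})` of `L·p`
collinear sub-steps of length `< R/p`, with the same endpoints, every point of which is within
`R` of a point of the original chain. (Used to trade the number of steps of a Harnack chain
against their size at a linear rate.) [folklore] -/
theorem refine_chain (z : ℕ → E) (L : ℕ) {R : ℝ} (hzd : ∀ i < L, dist (z (i + 1)) (z i) < R)
    {p : ℕ} (hp : 0 < p) :
    ∃ z' : ℕ → E, z' 0 = z 0 ∧ z' (L * p) = z L ∧
      (∀ i < L * p, dist (z' (i + 1)) (z' i) < R / p) ∧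
      (∀ i ≤ L * p, ∃ j ≤ L, dist (z' i) (z j) < R ∨ z' i = z j) := by
  have hpR : (0 : ℝ) < p := by exact_mod_cast hp
  -- the refined chain
  set z' : ℕ → E := fun i => z (i / p) + (((i % p : ℕ) : ℝ) / p) • (z (i / p + 1) - z (i / p))
    with hz'
  -- consecutive differences are `(1/p) (z_{i/p+1} − z_{i/p})`
  have hdiff : ∀ i, z' (i + 1) - z' i = (1 / (p : ℝ)) • (z (i / p + 1) - z (i / p)) := by
    intro i
    have e1 := Nat.mod_add_div i p
    have e2 := Nat.mod_add_div (i + 1) p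
    have b1 := Nat.mod_lt i hp
    rcases em (p ∣ i + 1) with hdvd | hndvd
    · have h1 : (i + 1) / p = i / p + 1 := by rw [Nat.succ_div, if_pos hdvd]
      rw [h1, mul_add, mul_one] at e2
      have h2 : (i + 1) % p = 0 := by omega
      have h3 : i % p = p - 1 := by omega
      simp only [hz', h1, h2, h3, Nat.cast_zero, zero_div, zero_smul, add_zero, Nat.cast_sub hp,
        Nat.cast_one]
      rw [show (((p : ℝ) - 1) / p) = 1 - 1 / p by field_simp, sub_smul, one_smul]
      abel
    · have h1 : (i + 1) / p = i / p := by rw [Nat.succ_div, if_neg hndvd, add_zero]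
      rw [h1] at e2
      have h2 : (i + 1) % p = i % p + 1 := by omega
      simp only [hz', h1, h2, Nat.cast_add, Nat.cast_one]
      rw [show (((i % p : ℕ) : ℝ) + 1) / p = ((i % p : ℕ) : ℝ) / p + 1 / p by ring, add_smul]
      abel
  refine ⟨z', ?_, ?_, ?_, ?_⟩
  · simp [hz']
  · simp [hz', Nat.mul_div_cancel _ hp, Nat.mul_mod_left]
  · intro i hi
    have hj : i / p < L := (Nat.div_lt_iff_lt_mul hp).2 hi
    have hstep : ‖z (i / p + 1) - z (i / p)‖ < R := by
      have := hzd (i / p) hj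
      rwa [dist_eq_norm] at this
    rw [dist_eq_norm, hdiff i, norm_smul, Real.norm_of_nonneg (by positivity), one_div,
      inv_mul_lt_iff₀ hpR]
    calc ‖z (i / p + 1) - z (i / p)‖ < R := hstep
      _ = p * (R / p) := by field_simp
  · intro i hi
    rcases Nat.lt_or_ge i (L * p) with hlt | hge
    · have hj : i / p < L := (Nat.div_lt_iff_lt_mul hp).2 hlt
      refine ⟨i / p, hj.le, Or.inl ?_⟩
      have hstep : ‖z (i / p + 1) - z (i / p)‖ < R := by
        have := hzd (i / p) hj
        rwa [dist_eq_norm] at this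
      have hfrac : ((i % p : ℕ) : ℝ) / p < 1 := by
        rw [div_lt_one hpR]
        exact_mod_cast Nat.mod_lt i hp
      have hfrac0 : 0 ≤ ((i % p : ℕ) : ℝ) / p := by positivity
      have hzi : z' i - z (i / p) = (((i % p : ℕ) : ℝ) / p) • (z (i / p + 1) - z (i / p)) := by
        simp only [hz', add_sub_cancel_left]
      rw [dist_eq_norm, hzi, norm_smul, Real.norm_of_nonneg hfrac0]
      calc ((i % p : ℕ) : ℝ) / p * ‖z (i / p + 1) - z (i / p)‖
          ≤ 1 * ‖z (i / p + 1) - z (i / p)‖ := by gcongr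
        _ < R := by rw [one_mul]; exact hstep
    · have hieq : i = L * p := le_antisymm hi hge
      refine ⟨L, le_rfl, Or.inr ?_⟩
      rw [hieq]
      simp [hz', Nat.mul_div_cancel _ hp, Nat.mul_mod_left]

end Refine

/-! ### Lemma 2.1 from the Harnack inequality with waiting time -/

section Lemma21

variable {E : Type*} [NormedAddCommGroup E] [InnerProductSpace ℝ E] [FiniteDimensional ℝ E]
  [MeasurableSpace E] [BorelSpace E]
set_option maxHeartbeats 400000 in -- buildfix (bf3-g26): 160k/180k FAIL, 200k PASS at accept time; line-neutral budget line
/-- **KNSS 2009, Lemma 2.1, from the interior Harnack inequality with waiting time**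
(Koch–Nadirashvili–Seregin–Šverák 2009, Lemma 2.1, p. 5, as vendored in `KNSS2009_lemma21`;
the interior regularity "[LSU]" of the printed compactness proof enters through Lieberman 1996,
Theorem 6.27 in its corrected rendering `Lieberman1996_harnack_drift_gap`, via oscillation
decay backwards in time and a two-phase Harnack chain with lags `≈ 4R²`; see the module
docstring). [cite: KochNadirashviliSereginSverak2009, Lemma 2.1 (arXiv p. 5)] -/
theorem KNSS2009_lemma21_of_harnack_gap (hH : Lieberman1996_harnack_drift_gap E) :
    KNSS2009_lemma21 E := by
  intro Ω Ω' K T τ A ε hΩo hΩb hΩc hΩ'Ω hKc hKΩ hτ hε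
  -- the case `K = ∅` is vacuous
  rcases K.eq_empty_or_nonempty with hKe | hKne
  · refine ⟨1, one_pos, ?_⟩
    intro a u M _ _ _ _ _ _ _ _ hK'
    obtain ⟨x, hx, -⟩ := hK'
    rw [hKe] at hx
    exact absurd hx (notMem_empty x)
  -- Step 1: geometry — a compact connected envelope of `Ω̄' ∪ K` in `Ω`, a margin, `r₀`
  have hS₀c : IsCompact (closure Ω' ∪ K) :=
    (Metric.isCompact_of_isClosed_isBounded isClosed_closure (hΩb.subset hΩ'Ω)).union hKc
  obtain ⟨S, hSc, hSconn, hS₀S, hSΩ⟩ := exists_isCompact_isConnected_superset hΩo hΩc hS₀c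
    (union_subset hΩ'Ω hKΩ) (hKne.mono subset_union_right)
  obtain ⟨m, hm, hmΩ⟩ := hSc.exists_cthickening_subset_open hΩo hSΩ
  have hball : ∀ z ∈ S, ∀ r ≤ m, closedBall z r ⊆ Ω := fun z hz r hr =>
    ((closedBall_subset_closedBall hr).trans (closedBall_subset_cthickening hz m)).trans hmΩ
  obtain ⟨r₀, hr₀⟩ : ∃ r₀ : ℝ, r₀ = min (m / 4) (Real.sqrt τ / 4) := ⟨_, rfl⟩
  have hr₀pos : 0 < r₀ := by
    rw [hr₀]; exact lt_min (by positivity) (by positivity)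
  have hr₀m : 4 * r₀ ≤ m := by
    have : r₀ ≤ m / 4 := by rw [hr₀]; exact min_le_left _ _
    linarith
  have hr₀τ : 16 * r₀ ^ 2 ≤ τ := by
    have h1 : r₀ ≤ Real.sqrt τ / 4 := by rw [hr₀]; exact min_le_right _ _
    have h2 : (4 * r₀) ^ 2 ≤ Real.sqrt τ ^ 2 :=
      pow_le_pow_left₀ (by positivity) (by linarith) 2
    rw [Real.sq_sqrt hτ.le] at h2
    have h3 : (4 * r₀) ^ 2 = 16 * r₀ ^ 2 := by ring
    linarith
  -- Step 2: the Harnack constant, the contraction factor `θ`, the depth `k`, the scale `ρ`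
  obtain ⟨C, hC1, hC⟩ := hH.exists_const A hr₀pos
  have hCpos : 0 < C := by linarith
  obtain ⟨θ, hθ⟩ : ∃ θ : ℝ, θ = 1 - 1 / C := ⟨_, rfl⟩
  have hθ0 : 0 ≤ θ := by
    have : 1 / C ≤ 1 := by rw [div_le_one hCpos]; exact hC1
    rw [hθ]; linarith
  have hθ1 : θ < 1 := by
    have : 0 < 1 / C := by positivity
    rw [hθ]; linarith
  obtain ⟨k, hk⟩ := exists_pow_lt_of_lt_one (show 0 < ε / 4 by positivity) hθ1
  obtain ⟨ρ, hρ⟩ : ∃ ρ : ℝ, ρ = r₀ / 4 ^ k := ⟨_, rfl⟩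
  have hρpos : 0 < ρ := by rw [hρ]; positivity
  have hρle : ρ ≤ r₀ := by
    rw [hρ, div_le_iff₀ (by positivity)]
    have : (1 : ℝ) ≤ 4 ^ k := one_le_pow₀ (by norm_num)
    nlinarith
  have hρ2 : 0 < ρ ^ 2 := by positivity
  have hρr₀2 : ρ ^ 2 ≤ r₀ ^ 2 := pow_le_pow_left₀ hρpos.le hρle 2
  have hρm : ρ ≤ m / 4 := by linarith
  -- the moving phase: the uniform `ρ/8`-chains of `S`, refined `p = N₁ + 1` times
  obtain ⟨R₁, hR₁⟩ : ∃ R₁ : ℝ, R₁ = ρ / 8 := ⟨_, rfl⟩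
  have hR₁pos : 0 < R₁ := by rw [hR₁]; positivity
  obtain ⟨N₁, hN⟩ := exists_uniform_chain hSc hSconn.isPreconnected hR₁pos
  obtain ⟨pN, hpN⟩ : ∃ pN : ℕ, pN = N₁ + 1 := ⟨_, rfl⟩
  have hpNpos : 0 < pN := by omega
  have hpNR : (0 : ℝ) < pN := by exact_mod_cast hpNpos
  have hN₁pN : (N₁ : ℝ) ≤ pN := by rw [hpN]; push_cast; linarith
  obtain ⟨RA, hRA⟩ : ∃ RA : ℝ, RA = ρ / (4 * pN) := ⟨_, rfl⟩
  have hRApos : 0 < RA := by rw [hRA]; positivity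
  have hRAρ : RA ≤ ρ / 4 := by
    rw [hRA, div_le_div_iff₀ (by positivity) (by norm_num)]
    have : (1 : ℝ) ≤ pN := by exact_mod_cast hpNpos
    nlinarith
  have hRA2 : 0 < RA ^ 2 := by positivity
  have hRA16 : 16 * RA ^ 2 ≤ ρ ^ 2 := by nlinarith
  have hRAr₀ : RA ≤ r₀ := by linarith
  have hR₁pRA : R₁ / pN < RA := by
    rw [hR₁, hRA, div_div, div_lt_div_iff₀ (by positivity) (by positivity)]
    nlinarith
  have hR₁RAm : R₁ + 4 * RA ≤ m := by rw [hR₁]; linarith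
  obtain ⟨ℓA, hℓA⟩ : ∃ ℓA : ℝ, ℓA = 7 / 2 * RA ^ 2 := ⟨_, rfl⟩
  have hℓApos : 0 < ℓA := by rw [hℓA]; positivity
  obtain ⟨NA, hNA⟩ : ∃ NA : ℕ, NA = N₁ * pN := ⟨_, rfl⟩
  obtain ⟨TA, hTA⟩ : ∃ TA : ℝ, TA = NA * ℓA := ⟨_, rfl⟩
  have hTA0 : 0 ≤ TA := by rw [hTA]; positivity
  have hTAle : TA ≤ 7 / 32 * ρ ^ 2 := by
    have hpRA : (pN : ℝ) * RA = ρ / 4 := by rw [hRA]; field_simp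
    have h1 : TA = 7 / 2 * ((N₁ : ℝ) * RA) * ((pN : ℝ) * RA) := by
      rw [hTA, hNA, hℓA]; push_cast; ring
    have h2 : (N₁ : ℝ) * RA ≤ (pN : ℝ) * RA := mul_le_mul_of_nonneg_right hN₁pN hRApos.le
    rw [h1, hpRA]
    rw [hpRA] at h2
    nlinarith only [h2, hρpos]
  -- the resting phase: radius `ρ/32`, at most `n_Bmax` steps
  obtain ⟨RB, hRB⟩ : ∃ RB : ℝ, RB = ρ / 32 := ⟨_, rfl⟩
  have hRBpos : 0 < RB := by rw [hRB]; positivity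
  have hRB2 : 0 < RB ^ 2 := by positivity
  have hRBr₀ : RB ≤ r₀ := by rw [hRB]; linarith
  have hRBm : 4 * RB ≤ m := by rw [hRB]; linarith
  have hRB1024 : RB ^ 2 = ρ ^ 2 / 1024 := by rw [hRB]; ring
  obtain ⟨nBmax, hnBmax⟩ : ∃ nBmax : ℕ, nBmax = ⌈T / (4 * RB ^ 2)⌉₊ + 1 := ⟨_, rfl⟩
  -- the total number of steps and `δ`
  obtain ⟨Ntot, hNtot⟩ : ∃ Ntot : ℕ, Ntot = NA + nBmax := ⟨_, rfl⟩
  obtain ⟨CN, hCN⟩ : ∃ CN : ℝ, CN = C ^ Ntot := ⟨_, rfl⟩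
  have hCN1 : 1 ≤ CN := by rw [hCN]; exact one_le_pow₀ hC1
  have hCNpos : 0 < CN := by linarith only [hCN1]
  refine ⟨ε / (4 * CN), by positivity, ?_⟩
  -- the solution
  intro a u M ham haA hu2 hDu hΔu hequ hM huM hnear t ht x hx
  obtain ⟨xK, hxK, hnear⟩ := hnear
  by_contra hlt
  rw [not_le] at hlt
  -- `w = M − u ≥ 0` solves the same equation
  set w : ℝ → E → ℝ := fun s z => -u s z + M with hwdef
  have hw : IsDriftHeatSolutionOn a w A (Ioc 0 T) Ω :=
    (isDriftHeatSolutionOn_Ioc_of_hyps ham haA hu2 hDu hΔu hequ).neg.add_const hΩo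
      ordConnected_Ioc M
  have hwbd : ∀ s ∈ Ioc 0 T, ∀ z ∈ Ω, 0 ≤ w s z ∧ w s z ≤ 2 * M := by
    intro s hs z hz
    have h := abs_le.1 (huM s hs z hz)
    simp only [hwdef]
    constructor <;> linarith only [h.1, h.2]
  have hw0 : ∀ s ∈ Ioc 0 T, ∀ z ∈ Ω, 0 ≤ w s z := fun s hs z hz => (hwbd s hs z hz).1
  have hwtx : ε * M < w t x := by
    simp only [hwdef]; linarith only [hlt]
  have htT : t < T := ht.2
  have hτt : τ < t := ht.1
  have hxS : x ∈ S := hS₀S (Or.inl (subset_closure hx))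
  have hxKS : xK ∈ S := hS₀S (Or.inr hxK)
  have hxKΩ : xK ∈ Ω := hKΩ hxK
  -- Step 3: a definite step back in time: `w(t − ρ²/2, x) ≥ εM/2`
  obtain ⟨t₁, ht₁⟩ : ∃ t₁ : ℝ, t₁ = t - ρ ^ 2 / 2 := ⟨_, rfl⟩
  have ht₁t : t₁ < t := by rw [ht₁]; linarith only [hρ2]
  have ht₁pos : ρ ^ 2 < t₁ := by
    rw [ht₁]; nlinarith only [hρr₀2, hr₀τ, hτt, hρ2]
  have hback : ε * M / 2 ≤ w t₁ x := by
    obtain ⟨s', hs'⟩ : ∃ s' : ℝ, s' = min T (t + ρ ^ 2 / 4) := ⟨_, rfl⟩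
    have hs'T : s' ≤ T := by rw [hs']; exact min_le_left _ _
    have hs't : t < s' := by rw [hs']; exact lt_min htT (by linarith only [hρ2])
    have hs'le : s' ≤ t + ρ ^ 2 / 4 := by rw [hs']; exact min_le_right _ _
    have hB : closedBall x r₀ ⊆ Ω := hball x hxS r₀ (by linarith only [hr₀m, hr₀pos])
    have hs'r : r₀ ^ 2 < s' := by nlinarith only [hr₀τ, hτt, hs't, hr₀pos]
    have htQ : t ∈ Ioo (s' - (r₀ / 4 ^ k) ^ 2) s' :=
      ⟨by rw [← hρ]; linarith only [hs'le, hρ2], hs't⟩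
    have ht₁Q : t₁ ∈ Ioo (s' - (r₀ / 4 ^ k) ^ 2) s' :=
      ⟨by rw [← hρ, ht₁]; linarith only [hs'le, hρ2], by linarith only [ht₁t, hs't]⟩
    have hxB : x ∈ ball x (r₀ / 4 ^ k) := mem_ball_self (by rw [← hρ]; exact hρpos)
    have hosc := hC.osc_iterate hC1 hΩo hw hwbd hr₀pos le_rfl hB hs'r hs'T k htQ hxB ht₁Q hxB
    rw [← hθ] at hosc
    have h2 : θ ^ k * (2 * M - 0) ≤ ε / 4 * (2 * M) := by
      rw [sub_zero]
      exact mul_le_mul_of_nonneg_right hk.le (by linarith only [hM])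
    linarith only [hosc, h2, hwtx]
  -- Step 4: the two-phase Harnack chain from `(x, t₁)` to `(x_K, t₂)` for `t < t₂ < T`
  obtain ⟨tA, htA⟩ : ∃ tA : ℝ, tA = t₁ + TA := ⟨_, rfl⟩
  have hchainA : w t₁ x ≤ C ^ NA * w tA xK := by
    -- the chain of points: refine the uniform chain, pad at `x_K`
    obtain ⟨L, hLN, z, hz0, hzL, hzS, hzd⟩ := hN x hxS xK hxKS
    have hzd' : ∀ i < L, dist (z (i + 1)) (z i) < R₁ := fun i hi => by
      rw [dist_comm]; exact hzd i hi
    obtain ⟨z', hz'0, hz'L, hz'd, hz'near⟩ := refine_chain z L hzd' hpNpos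
    set Z : ℕ → E := fun i => if i ≤ L * pN then z' i else xK with hZ
    have hZ0 : Z 0 = x := by simp [hZ, hz'0, hz0]
    have hLNA : L * pN ≤ NA := by rw [hNA]; exact Nat.mul_le_mul_right _ hLN
    have hZNA : Z NA = xK := by
      by_cases h : NA ≤ L * pN
      · have : NA = L * pN := le_antisymm h hLNA
        simp [hZ, this, hz'L, hzL]
      · simp [hZ, h]
    have hZΩ : ∀ i, closedBall (Z i) (4 * RA) ⊆ Ω := by
      intro i
      by_cases hi : i ≤ L * pN
      · simp only [hZ, hi, if_true]
        obtain ⟨j, hj, hij⟩ := hz'near i hi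
        have hzjS : z j ∈ S := hzS j hj
        have hsub : closedBall (z' i) (4 * RA) ⊆ closedBall (z j) (R₁ + 4 * RA) := by
          intro y hy
          rw [mem_closedBall] at hy ⊢
          rcases hij with hij | hij
          · calc dist y (z j) ≤ dist y (z' i) + dist (z' i) (z j) := dist_triangle _ _ _
              _ ≤ 4 * RA + R₁ := by linarith only [hy, hij]
              _ = R₁ + 4 * RA := by ring
          · rw [← hij]; linarith only [hy, hR₁pos]
        exact hsub.trans (hball (z j) hzjS _ hR₁RAm)
      · simp only [hZ, hi, if_false]
        exact hball xK hxKS _ (by linarith only [hR₁RAm, hR₁pos])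
    set σ : ℕ → ℝ := fun i => t₁ + i * ℓA with hσ
    have hσ0 : σ 0 = t₁ := by simp [hσ]
    have hσNA : σ NA = tA := by simp only [hσ, htA, hTA]
    have hch := hC.chain hCpos.le hΩo hw hw0 hRApos hRAr₀ Z σ NA ?_ (fun i _ => hZΩ i) ?_
    · rwa [hσ0, hZ0, hσNA, hZNA] at hch
    · -- consecutive points are `R_A`-close
      intro i hi
      by_cases hi1 : i + 1 ≤ L * pN
      · have hi' : i ≤ L * pN := by omega
        simp only [hZ, hi1, hi', if_true]
        exact (hz'd i (by omega)).trans hR₁pRA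
      · by_cases hi' : i ≤ L * pN
        · have hieq : i = L * pN := by omega
          simp only [hZ, hi1, hi', if_false, if_true]
          rw [hieq, hz'L, hzL, dist_self]; exact hRApos
        · simp only [hZ, hi1, hi', if_false, dist_self]; exact hRApos
    · -- the tops `σ i + 33 R_A²/8`
      intro i hi
      have hσi : σ i = t₁ + i * ℓA := rfl
      have hσi1 : σ (i + 1) = σ i + ℓA := by simp only [hσ]; push_cast; ring
      have hile : (i : ℝ) + 1 ≤ NA := by exact_mod_cast Nat.succ_le_of_lt hi
      have hi0 : (0 : ℝ) ≤ i := Nat.cast_nonneg i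
      have hσi_ge : t₁ ≤ σ i := by
        have := mul_nonneg hi0 hℓApos.le
        rw [hσi]; linarith only [this]
      have hσi_le : σ i + ℓA ≤ t₁ + TA := by
        rw [hσi, hTA]
        have := mul_le_mul_of_nonneg_right hile hℓApos.le
        linarith only [this]
      refine ⟨σ i + 33 / 8 * RA ^ 2, by linarith only [hσi_ge, ht₁pos, hRA16, hRA2], ?_, ?_, ?_⟩
      · -- below `T`
        rw [hℓA] at hσi_le
        have : TA ≤ 7 / 32 * ρ ^ 2 := hTAle
        nlinarith only [hσi_le, this, ht₁, htT, hRA16, hRA2]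
      · constructor <;> nlinarith only [hRA2]
      · rw [hσi1, hℓA]; constructor <;> nlinarith only [hRA2]
  have hchain : ∀ t₂ ∈ Ioo t T, ε * M / 2 ≤ CN * w t₂ xK := by
    intro t₂ ht₂
    have ht₂t : t < t₂ := ht₂.1
    have ht₂T : t₂ < T := ht₂.2
    -- the resting phase from `(x_K, t_A)` to `(x_K, t₂)`
    obtain ⟨ΛB, hΛB⟩ : ∃ ΛB : ℝ, ΛB = t₂ - tA := ⟨_, rfl⟩
    have hΛBge : 9 / 32 * ρ ^ 2 ≤ ΛB := by
      rw [hΛB, htA, ht₁]; linarith only [hTAle, ht₂t]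
    have hΛBpos : 0 < ΛB := by linarith only [hΛBge, hρ2]
    have htApos : 0 < tA := by rw [htA]; linarith only [ht₁pos, hρ2, hTA0]
    have hΛBT : ΛB ≤ T := by rw [hΛB]; linarith only [htApos, ht₂T]
    obtain ⟨nB, hnB⟩ : ∃ nB : ℕ, nB = ⌈ΛB / (21 / 5 * RB ^ 2)⌉₊ := ⟨_, rfl⟩
    have hq0 : 0 ≤ ΛB / (21 / 5 * RB ^ 2) := by positivity
    have hnBge : ΛB / (21 / 5 * RB ^ 2) ≤ nB := by rw [hnB]; exact Nat.le_ceil _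
    have hnBlt : (nB : ℝ) < ΛB / (21 / 5 * RB ^ 2) + 1 := by rw [hnB]; exact Nat.ceil_lt_add_one hq0
    have hnBposR : (0 : ℝ) < nB := lt_of_lt_of_le (by positivity) hnBge
    have hnBpos : 0 < nB := by exact_mod_cast hnBposR
    have hnBle : nB ≤ nBmax := by
      have h1 : ΛB / (21 / 5 * RB ^ 2) ≤ T / (4 * RB ^ 2) := by
        rw [div_le_div_iff₀ (by positivity) (by positivity)]
        nlinarith only [hΛBT, hRB2, hΛBpos]
      have h2 : (nB : ℝ) < ⌈T / (4 * RB ^ 2)⌉₊ + 1 := by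
        have := Nat.le_ceil (T / (4 * RB ^ 2))
        linarith only [hnBlt, h1, this]
      have h3 : nB < ⌈T / (4 * RB ^ 2)⌉₊ + 1 := by exact_mod_cast h2
      rw [hnBmax]; omega
    obtain ⟨ℓB, hℓB⟩ : ∃ ℓB : ℝ, ℓB = ΛB / nB := ⟨_, rfl⟩
    have hℓBn : (nB : ℝ) * ℓB = ΛB := by rw [hℓB]; field_simp
    have hℓBle : ℓB ≤ 21 / 5 * RB ^ 2 := by
      rw [hℓB, div_le_iff₀ hnBposR]
      rw [div_le_iff₀ (by positivity)] at hnBge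
      linarith only [hnBge]
    have hℓBge : 81 / 20 * RB ^ 2 ≤ ℓB := by
      rw [hℓB, le_div_iff₀ hnBposR]
      -- `(81/20) R_B² n_B < (27/28) Λ_B + (81/20) R_B² ≤ Λ_B` as `R_B² ≤ (5/567) Λ_B`
      have h1 : (nB : ℝ) * (21 / 5 * RB ^ 2) < ΛB + 21 / 5 * RB ^ 2 := by
        have := (mul_lt_mul_of_pos_right hnBlt (show 0 < 21 / 5 * RB ^ 2 by positivity))
        rwa [add_mul, one_mul, div_mul_cancel₀ _ (by positivity)] at this
      have h2 : RB ^ 2 ≤ 5 / 567 * ΛB := by rw [hRB1024]; linarith only [hΛBge, hρ2]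
      nlinarith only [h1, h2, hRB2]
    obtain ⟨ν, hν⟩ : ∃ ν : ℝ, ν = min (RB ^ 2 / 32) ((T - t₂) / 2) := ⟨_, rfl⟩
    have hνpos : 0 < ν := by rw [hν]; exact lt_min (by positivity) (by linarith only [ht₂T])
    have hν1 : ν ≤ RB ^ 2 / 32 := by rw [hν]; exact min_le_left _ _
    have hν2 : ν ≤ (T - t₂) / 2 := by rw [hν]; exact min_le_right _ _
    set σ' : ℕ → ℝ := fun j => tA + j * ℓB with hσ'
    have hσ'0 : σ' 0 = tA := by simp [hσ']
    have hσ'n : σ' nB = t₂ := by simp only [hσ', hℓBn, hΛB]; ring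
    have hchB := hC.chain hCpos.le hΩo hw hw0 hRBpos hRBr₀ (fun _ => xK) σ' nB
      (fun i _ => by rw [dist_self]; exact hRBpos) (fun i _ => hball xK hxKS _ hRBm) ?_
    · rw [hσ'0, hσ'n] at hchB
      -- assemble: `εM/2 ≤ w(t₁,x) ≤ C^{N_A} w(t_A,x_K) ≤ C^{N_A} C^{n_B} w(t₂,x_K) ≤ C^{N_tot} w(t₂,x_K)`
      have hwt₂ : 0 ≤ w t₂ xK := hw0 t₂ ⟨by linarith only [htApos, hΛBpos, hΛB], ht₂T.le⟩ xK hxKΩ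
      have h1 : w t₁ x ≤ C ^ NA * (C ^ nB * w t₂ xK) :=
        hchainA.trans (mul_le_mul_of_nonneg_left hchB (pow_nonneg hCpos.le _))
      have h2 : C ^ NA * (C ^ nB * w t₂ xK) = C ^ (NA + nB) * w t₂ xK := by rw [pow_add]; ring
      have h3 : C ^ (NA + nB) ≤ CN := by
        rw [hCN]; exact pow_le_pow_right₀ hC1 (by rw [hNtot]; omega)
      calc ε * M / 2 ≤ w t₁ x := hback
        _ ≤ C ^ (NA + nB) * w t₂ xK := by rw [← h2]; exact h1
        _ ≤ CN * w t₂ xK := mul_le_mul_of_nonneg_right h3 hwt₂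
    · -- the tops `σ' (j+1) + ν`
      intro j hj
      have hσ'j1 : σ' (j + 1) = σ' j + ℓB := by simp only [hσ']; push_cast; ring
      have hjle : (j : ℝ) + 1 ≤ nB := by exact_mod_cast Nat.succ_le_of_lt hj
      have hj0 : (0 : ℝ) ≤ j := Nat.cast_nonneg j
      have hσ'j_ge : tA ≤ σ' j := by
        have := mul_nonneg hj0 (show 0 ≤ ℓB by linarith only [hℓBge, hRB2])
        show tA ≤ tA + j * ℓB; linarith only [this]
      have hσ'j1_le : σ' (j + 1) ≤ t₂ := by
        have := mul_le_mul_of_nonneg_right hjle (show 0 ≤ ℓB by linarith only [hℓBge, hRB2])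
        rw [← hσ'n]
        show tA + ((j + 1 : ℕ) : ℝ) * ℓB ≤ tA + nB * ℓB
        push_cast; linarith only [this]
      refine ⟨σ' (j + 1) + ν, ?_, by linarith only [hσ'j1_le, hν2, ht₂T], ?_, ?_⟩
      · rw [hσ'j1]
        have : 16 * RB ^ 2 ≤ ρ ^ 2 := by rw [hRB1024]; linarith only [hρ2]
        linarith only [hσ'j_ge, htApos, this, ht₁pos, htA, hTA0, hℓBge, hRB2, hνpos]
      · rw [hσ'j1]; constructor <;> linarith only [hℓBle, hℓBge, hν1, hνpos, hRB2]
      · constructor <;> linarith only [hν1, hνpos, hRB2]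
  -- Step 5: let `t₂ → T` (time-Lipschitz bound at `x_K`)
  have hTpos : 0 < T := by linarith only [hτ, hτt, htT]
  have hT2 : Icc (T / 2) T ⊆ Ioc 0 T := fun s hs => ⟨by linarith only [hs.1, hTpos], hs.2⟩
  obtain ⟨Lip, hLip⟩ := hw.exists_abs_sub_le hT2 isCompact_singleton (singleton_subset_iff.2 hxKΩ)
  have hclaim : ε * M / 2 ≤ CN * w T xK := by
    by_contra hcl
    rw [not_le] at hcl
    obtain ⟨gap, hgap⟩ : ∃ gap : ℝ, gap = ε * M / 2 - CN * w T xK := ⟨_, rfl⟩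
    have hgap0 : 0 < gap := by rw [hgap]; linarith only [hcl]
    obtain ⟨ι, hι⟩ : ∃ ι : ℝ, ι = min (min ((T - t) / 2) (T / 4))
      (gap / (2 * CN * (|Lip| + 1))) := ⟨_, rfl⟩
    have hιpos : 0 < ι := by
      rw [hι]
      exact lt_min (lt_min (by linarith only [htT]) (by linarith only [hTpos])) (by positivity)
    have hι1 : ι ≤ (T - t) / 2 := by rw [hι]; exact (min_le_left _ _).trans (min_le_left _ _)
    have hι3 : ι ≤ T / 4 := by rw [hι]; exact (min_le_left _ _).trans (min_le_right _ _)
    have hι4 : ι ≤ gap / (2 * CN * (|Lip| + 1)) := by rw [hι]; exact min_le_right _ _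
    have ht₂mem : T - ι ∈ Ioo t T := ⟨by linarith only [hι1, htT], by linarith only [hιpos]⟩
    have h1 := hchain (T - ι) ht₂mem
    have h2 : |w T xK - w (T - ι) xK| ≤ Lip * |T - (T - ι)| :=
      hLip xK (mem_singleton xK) (T - ι) ⟨by linarith only [hι3, hTpos], by linarith only [hιpos]⟩
        T ⟨by linarith only [hTpos], le_rfl⟩
    rw [show T - (T - ι) = ι by ring, abs_of_pos hιpos] at h2
    have h4 : Lip * ι ≤ |Lip| * ι := mul_le_mul_of_nonneg_right (le_abs_self _) hιpos.le
    have h3 : w (T - ι) xK ≤ w T xK + |Lip| * ι := by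
      linarith only [(abs_le.1 (h2.trans h4)).1]
    have h5 : CN * (|Lip| * ι) ≤ gap / 2 := by
      have hden : 0 < 2 * CN * (|Lip| + 1) := by positivity
      have h6 : |Lip| * ι ≤ |Lip| * (gap / (2 * CN * (|Lip| + 1))) :=
        mul_le_mul_of_nonneg_left hι4 (abs_nonneg _)
      have h7 : CN * (|Lip| * (gap / (2 * CN * (|Lip| + 1)))) ≤ gap / 2 := by
        rw [show CN * (|Lip| * (gap / (2 * CN * (|Lip| + 1)))) =
          gap / 2 * (CN * |Lip| / (CN * (|Lip| + 1))) by field_simp]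
        have h8 : CN * |Lip| / (CN * (|Lip| + 1)) ≤ 1 := by
          rw [div_le_one (by positivity)]; nlinarith only [abs_nonneg Lip, hCNpos]
        calc gap / 2 * (CN * |Lip| / (CN * (|Lip| + 1))) ≤ gap / 2 * 1 :=
              mul_le_mul_of_nonneg_left h8 (by linarith only [hgap0])
          _ = gap / 2 := mul_one _
      exact (mul_le_mul_of_nonneg_left h6 hCNpos.le).trans h7
    have h9 : CN * w (T - ι) xK ≤ CN * w T xK + CN * (|Lip| * ι) := by
      have := mul_le_mul_of_nonneg_left h3 hCNpos.le
      linarith only [this]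
    linarith only [h1, h9, h5, hgap, hcl]
  -- Step 6: contradiction with `u(T, x_K) ≥ M(1 − δ)`
  have hwT : w T xK ≤ ε / (4 * CN) * M := by
    simp only [hwdef]
    have h1 : M * (1 - ε / (4 * CN)) ≤ u T xK := hnear
    have h2 : M * (1 - ε / (4 * CN)) = M - ε / (4 * CN) * M := by ring
    linarith only [h1, h2]
  have h10 : CN * w T xK ≤ ε * M / 4 := by
    calc CN * w T xK ≤ CN * (ε / (4 * CN) * M) := mul_le_mul_of_nonneg_left hwT hCNpos.le
      _ = ε * M / 4 := by field_simp
  have hεM : 0 < ε * M := mul_pos hε hM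
  linarith only [hclaim, h10, hεM]

/-! ### The consumers, re-threaded to the corrected Harnack fact -/

/-- **The core of KNSS 2009, Theorem 5.3, from Lieberman's interior Harnack inequality (with
waiting time) alone**: `KNSS2009_swirl_sup_nonpos` — a bounded axisymmetric ancient solution
`f` of the swirl equation (5.10) with drift `|u| ≤ C/r`, `f = 0` on the axis, is `≤ 0` — follows
from `Lieberman1996_harnack_drift_gap` on `ℝ³`, through `KNSS2009_lemma21_of_harnack_gap` and
the accepted `KNSS2009_swirl_sup_nonpos_of_lemma21`. [cite: KochNadirashviliSereginSverak2009, proof of Thm 5.3 (arXiv p. 10)] -/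
theorem KNSS2009_swirl_sup_nonpos_of_harnack_gap
    (hH : Lieberman1996_harnack_drift_gap (EuclideanSpace ℝ (Fin 3))) :
    KNSS2009_swirl_sup_nonpos :=
  KNSS2009_swirl_sup_nonpos_of_lemma21 (KNSS2009_lemma21_of_harnack_gap hH)

/-- **KNSS 2009, Theorem 5.3 as printed, from Lieberman's Theorem 6.27 (with waiting time), the
§4 regularity / swirl-equation fact and Theorem 5.2.** [cite: KochNadirashviliSereginSverak2009, Thm 5.3 (arXiv p. 10)] -/
theorem KNSS2009_liouville_bound_C_over_r_of_harnack_gap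
    (hH : Lieberman1996_harnack_drift_gap (EuclideanSpace ℝ (Fin 3)))
    (hreg : KNSS2009_regularity_axisymmetric_swirl)
    (h52 : KNSS2009_liouville_axisymmetric_no_swirl) : KNSS2009_liouville_bound_C_over_r :=
  KNSS2009_liouville_bound_C_over_r_of_lemma21 (KNSS2009_lemma21_of_harnack_gap hH) hreg h52

/-- **The tree's duality-form fact `knss_bound_C_over_r` from Lieberman's Theorem 6.27 (with
waiting time), the §4 regularity / swirl-equation fact and Theorem 5.2** (through
`knss_bound_C_over_r_of_facts`, `KNSSThm53Reduction`). [cite: KochNadirashviliSereginSverak2009, Thm 5.3 (arXiv p. 10)] -/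
theorem knss_bound_C_over_r_of_harnack_gap
    (hH : Lieberman1996_harnack_drift_gap (EuclideanSpace ℝ (Fin 3)))
    (hreg : KNSS2009_regularity_axisymmetric_swirl)
    (h52 : KNSS2009_liouville_axisymmetric_no_swirl) : knss_bound_C_over_r :=
  knss_bound_C_over_r_of_facts hreg (KNSS2009_swirl_sup_nonpos_of_harnack_gap hH) h52

end Lemma21

end Literature.Analysis.FluidPDE

end
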